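import Summits.ResolutionOfSingularities.ResolutionOfSingularities.Theorems.WeightedInvariantEssSmoothLocalHomOrder
import Summits.ResolutionOfSingularities.ResolutionOfSingularities.Theorems.WeightedInvariantHypersurfaceLocalGameEFT4SDimLE
import Literature.AlgebraicGeometry.Resolution.FlatLocalRegularAscent
import Literature.AlgebraicGeometry.Resolution.RegularLocalRingsFlatDescent
import Literature.AlgebraicGeometry.Resolution.CotangentFlatAscent
import Literature.AlgebraicGeometry.Resolution.StrictNormalCrossingsAt
import Literature.RingTheory.Flat.RegularFibreFlat
import HarnessLib

/-!
# E2 centre, ring-level hand (G-0), part (c), I: LOCALISING A SMOOTH RING MAP AT A PRIME — the legs along which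
# (c11)≤d, orders, regularity and cotangent classes are transported

[OURS · L1 W4.3 · DOOR `HypersurfaceCentreConstruction` stmt-ResolutionOfSingularities-19897 · E2 tier, centre piece
(C-c) `E2CentreGlueBody`, DESIGN MEMO v0 `L/res-L1-w43-plan-1/E2-CENTRE-GLUE-DESIGN-v0.md` (registrar res-L1-w43-plan-1)
§2 (G-0), «base change input»; ring-level hand res-L1-s36-pv-1, SHAPE LINE (HOME/STATUS 2026-08-27 l.70636) part (c).
Generic commutative algebra (Mathlib `Localization.localRingHom`, formal smoothness, essential finiteness, flatness) +
the tree's Matsumura 23.7 / 15.1 files; nothing here is a statement of, or about, the manuscript under adjudication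
(Hironaka 2017); candidate-design support, AI-written, weaker than expert review.]

For a SMOOTH ring map `φ : A → C` (`RingHom.Smooth`), a prime `𝔓` of `C` and `𝔭 = φ⁻¹ 𝔓`, the induced local map
`ψ : A_𝔭 → C_𝔓` is formally smooth and essentially of finite type (`formallySmooth_essFiniteType_localRingHom`), hence
flat (`flat_localRingHom`) and faithfully flat (`comap_map_localRingHom`); regularity ascends when `𝔓 = 𝔭·C`
(`isRegularLocalRing_localization_of_map_eq`) and in general (`isRegularLocalRing_localization_of_smooth`, regular closed
fibre) and descends (`isRegularLocalRing_localization_of_smooth_comap`); the rung clause (c11)≤d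
`IotaJEssSmoothCompatibleLE d ι J` can be READ ALONG `ψ` (`iotaJ_localization_eq_of_smooth`), as can `𝔪`-adic orders
(`mem_pow_maximalIdeal_localization_iff_of_smooth`) and linear independence of cotangent classes
(`linearIndependent_toCotangent_localRingHom_of_smooth` ascent, `linearIndependent_toCotangent_of_map` descent,
`linearIndependent_toCotangent_of_unit_mul`).  The sequel `…E2CoreInvariance` applies this to the two smooth maps
`ι₀, ρ : A → A[ℤʲ]` (projection and coaction of a `ℤʲ`-grading).
-/

set_option linter.dupNamespace false

noncomputable section

open IsLocalRing
open Literature.AlgebraicGeometry.Resolution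

namespace Summit.ResolutionOfSingularities.ResolutionOfSingularities.Cruxes.HypersurfaceCentreConstruction.LocalEngine

namespace E2Model

/-! ## §1 Localising a smooth ring map at a prime: the (c11)-legs -/

section LocalizedSmooth

variable {A C : Type} [CommRing A] [CommRing C] (φ : A →+* C)
  (𝔓 : Ideal C) [𝔓.IsPrime] (𝔭 : Ideal A) [𝔭.IsPrime] (h𝔭 : 𝔭 = 𝔓.comap φ)

include h𝔭

/-- Along a SMOOTH ring map `φ : A → C`, the induced local map `A_𝔭 → C_𝔓` (`𝔭 = φ⁻¹ 𝔓`, Mathlib's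
`Localization.localRingHom`) is FORMALLY SMOOTH and ESSENTIALLY OF FINITE TYPE (with the scalar tower over `A`).
[OURS · bookkeeping for (c11)] -/
theorem formallySmooth_essFiniteType_localRingHom (hφ : φ.Smooth) :
    letI := (Localization.localRingHom 𝔭 𝔓 φ h𝔭).toAlgebra
    Algebra.FormallySmooth (Localization.AtPrime 𝔭) (Localization.AtPrime 𝔓) ∧
      Algebra.EssFiniteType (Localization.AtPrime 𝔭) (Localization.AtPrime 𝔓) := by
  letI algAC : Algebra A C := φ.toAlgebra
  haveI : Algebra.Smooth A C := hφ
  letI algSS' : Algebra (Localization.AtPrime 𝔭) (Localization.AtPrime 𝔓) :=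
    (Localization.localRingHom 𝔭 𝔓 φ h𝔭).toAlgebra
  haveI : IsScalarTower A C (Localization.AtPrime 𝔓) := inferInstance
  haveI : IsScalarTower A (Localization.AtPrime 𝔭) (Localization.AtPrime 𝔓) := by
    refine IsScalarTower.of_algebraMap_eq' ?_
    ext a
    rw [IsScalarTower.algebraMap_apply A C (Localization.AtPrime 𝔓), RingHom.comp_apply]
    change algebraMap C (Localization.AtPrime 𝔓) (φ a) =
      Localization.localRingHom 𝔭 𝔓 φ h𝔭 (algebraMap A (Localization.AtPrime 𝔭) a)
    rw [Localization.localRingHom_to_map]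
  have hFS : Algebra.FormallySmooth A (Localization.AtPrime 𝔓) :=
    Algebra.FormallySmooth.comp A C (Localization.AtPrime 𝔓)
  have hEFT : Algebra.EssFiniteType A (Localization.AtPrime 𝔓) :=
    Algebra.EssFiniteType.comp A C (Localization.AtPrime 𝔓)
  exact ⟨Algebra.FormallySmooth.localization_base 𝔭.primeCompl,
    Algebra.EssFiniteType.of_comp A (Localization.AtPrime 𝔭) (Localization.AtPrime 𝔓)⟩

/-- The localised map is FLAT (formally smooth + essentially of finite type over a Noetherian local ring; tree
`flat_of_formallySmooth_of_essFiniteType`). [OURS · bookkeeping] -/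
theorem flat_localRingHom [IsNoetherianRing A] (hφ : φ.Smooth) :
    letI := (Localization.localRingHom 𝔭 𝔓 φ h𝔭).toAlgebra
    Module.Flat (Localization.AtPrime 𝔭) (Localization.AtPrime 𝔓) := by
  letI algSS' : Algebra (Localization.AtPrime 𝔭) (Localization.AtPrime 𝔓) :=
    (Localization.localRingHom 𝔭 𝔓 φ h𝔭).toAlgebra
  obtain ⟨h1, h2⟩ := formallySmooth_essFiniteType_localRingHom φ 𝔓 𝔭 h𝔭 hφ
  exact flat_of_formallySmooth_of_essFiniteType (Localization.AtPrime 𝔭) (Localization.AtPrime 𝔓)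

/-- FAITHFUL FLATNESS of the localised map: extension followed by contraction is the identity on ideals of `A_𝔭`.
[OURS · bookkeeping] -/
theorem comap_map_localRingHom [IsNoetherianRing A] (hφ : φ.Smooth) (I : Ideal (Localization.AtPrime 𝔭)) :
    (I.map (Localization.localRingHom 𝔭 𝔓 φ h𝔭)).comap (Localization.localRingHom 𝔭 𝔓 φ h𝔭) = I := by
  letI algSS' : Algebra (Localization.AtPrime 𝔭) (Localization.AtPrime 𝔓) :=
    (Localization.localRingHom 𝔭 𝔓 φ h𝔭).toAlgebra
  haveI : Module.Flat (Localization.AtPrime 𝔭) (Localization.AtPrime 𝔓) := flat_localRingHom φ 𝔓 𝔭 h𝔭 hφ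
  haveI : IsLocalHom (algebraMap (Localization.AtPrime 𝔭) (Localization.AtPrime 𝔓)) :=
    Localization.isLocalHom_localRingHom 𝔭 𝔓 φ h𝔭
  haveI : Module.FaithfullyFlat (Localization.AtPrime 𝔭) (Localization.AtPrime 𝔓) :=
    Module.FaithfullyFlat.of_flat_of_isLocalHom
  exact Ideal.comap_map_eq_self_of_faithfullyFlat I

/-- REGULAR ASCENT along the localised map when `𝔓 = 𝔭·C` (trivial closed fibre: `𝔪_𝔭 C_𝔓 = 𝔪_𝔓`; Matsumura 23.7 via
the tree's `IsRegularLocalRing.of_flat_of_map_maximalIdeal_eq`). [OURS · bookkeeping] -/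
theorem isRegularLocalRing_localization_of_map_eq [IsNoetherianRing A] [IsNoetherianRing C] (hφ : φ.Smooth)
    (hmap : 𝔭.map φ = 𝔓) [IsRegularLocalRing (Localization.AtPrime 𝔭)] :
    IsRegularLocalRing (Localization.AtPrime 𝔓) := by
  letI algSS' : Algebra (Localization.AtPrime 𝔭) (Localization.AtPrime 𝔓) :=
    (Localization.localRingHom 𝔭 𝔓 φ h𝔭).toAlgebra
  haveI : Module.Flat (Localization.AtPrime 𝔭) (Localization.AtPrime 𝔓) := flat_localRingHom φ 𝔓 𝔭 h𝔭 hφ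
  haveI : IsLocalHom (algebraMap (Localization.AtPrime 𝔭) (Localization.AtPrime 𝔓)) :=
    Localization.isLocalHom_localRingHom 𝔭 𝔓 φ h𝔭
  refine IsRegularLocalRing.of_flat_of_map_maximalIdeal_eq (Localization.AtPrime 𝔭) (Localization.AtPrime 𝔓) ?_
  have hcomp : (algebraMap (Localization.AtPrime 𝔭) (Localization.AtPrime 𝔓)).comp
      (algebraMap A (Localization.AtPrime 𝔭)) = (algebraMap C (Localization.AtPrime 𝔓)).comp φ := by
    ext a
    exact Localization.localRingHom_to_map 𝔭 𝔓 φ h𝔭 a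
  rw [← Localization.AtPrime.map_eq_maximalIdeal, ← Localization.AtPrime.map_eq_maximalIdeal, Ideal.map_map,
    hcomp, ← Ideal.map_map, hmap]

/-- REGULAR DESCENT along the localised map (Matsumura 23.7 (i), tree `IsRegularLocalRing.of_flat_of_isLocalHom`).
[OURS · bookkeeping] -/
theorem isRegularLocalRing_localization_of_smooth_comap [IsNoetherianRing A] (hφ : φ.Smooth)
    [IsRegularLocalRing (Localization.AtPrime 𝔓)] : IsRegularLocalRing (Localization.AtPrime 𝔭) := by
  letI algSS' : Algebra (Localization.AtPrime 𝔭) (Localization.AtPrime 𝔓) :=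
    (Localization.localRingHom 𝔭 𝔓 φ h𝔭).toAlgebra
  haveI : Module.Flat (Localization.AtPrime 𝔭) (Localization.AtPrime 𝔓) := flat_localRingHom φ 𝔓 𝔭 h𝔭 hφ
  haveI : IsLocalHom (algebraMap (Localization.AtPrime 𝔭) (Localization.AtPrime 𝔓)) :=
    Localization.isLocalHom_localRingHom 𝔭 𝔓 φ h𝔭
  exact IsRegularLocalRing.of_flat_of_isLocalHom (Localization.AtPrime 𝔭) (Localization.AtPrime 𝔓)

/-- REGULAR ASCENT along the localised map of a smooth ring map, general prime `𝔓` over `𝔭` (Matsumura 23.7 (ii):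
flat, base regular, closed fibre regular — the fibre of a formally smooth essentially-finite-type local map is regular,
tree `isRegularLocalRing_fiber`; dimension formula `ringKrullDim_eq_add_of_flat`). [OURS · bookkeeping] -/
theorem isRegularLocalRing_localization_of_smooth [IsNoetherianRing A] [IsNoetherianRing C] (hφ : φ.Smooth)
    [IsRegularLocalRing (Localization.AtPrime 𝔭)] : IsRegularLocalRing (Localization.AtPrime 𝔓) := by
  letI algSS' : Algebra (Localization.AtPrime 𝔭) (Localization.AtPrime 𝔓) :=
    (Localization.localRingHom 𝔭 𝔓 φ h𝔭).toAlgebra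
  obtain ⟨h1, h2⟩ := formallySmooth_essFiniteType_localRingHom φ 𝔓 𝔭 h𝔭 hφ
  haveI := h1
  haveI := h2
  haveI : Module.Flat (Localization.AtPrime 𝔭) (Localization.AtPrime 𝔓) := flat_localRingHom φ 𝔓 𝔭 h𝔭 hφ
  haveI : IsLocalHom (algebraMap (Localization.AtPrime 𝔭) (Localization.AtPrime 𝔓)) :=
    Localization.isLocalHom_localRingHom 𝔭 𝔓 φ h𝔭
  have hF := isRegularLocalRing_fiber (Localization.AtPrime 𝔭) (Localization.AtPrime 𝔓)
  have hdim := ringKrullDim_eq_add_of_flat (R := Localization.AtPrime 𝔭) (S := Localization.AtPrime 𝔓)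
  exact (Literature.RingTheory.Flat.isRegularLocalRing_of_isRegularLocalRing_fiber hF hdim.symm.le).1

omit h𝔭 in
/-- A unit rescaling does not affect linear independence of cotangent classes. [OURS · bookkeeping] -/
theorem linearIndependent_toCotangent_of_unit_mul {S : Type*} [CommRing S] [IsLocalRing S] {ι : Type*} [Fintype ι]
    (y : ι → S) (v : ι → S) (hv : ∀ i, IsUnit (v i)) (hvy : ∀ i, v i * y i ∈ maximalIdeal S)
    (hli : LinearIndependent (ResidueField S) fun i => (maximalIdeal S).toCotangent ⟨v i * y i, hvy i⟩)
    (hy : ∀ i, y i ∈ maximalIdeal S) :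
    LinearIndependent (ResidueField S) fun i => (maximalIdeal S).toCotangent ⟨y i, hy i⟩ := by
  rw [linearIndependent_toCotangent_iff_forall_mem] at hli ⊢
  intro c hc i
  have hw : ∀ j, ∃ w : S, w * v j = 1 := fun j => (hv j).exists_left_inv
  choose w hw using hw
  have hc' : ∑ j, (c j * w j) * (v j * y j) ∈ maximalIdeal S ^ 2 := by
    have : ∑ j, (c j * w j) * (v j * y j) = ∑ j, c j * y j :=
      Finset.sum_congr rfl fun j _ => by
        calc (c j * w j) * (v j * y j) = c j * ((w j * v j) * y j) := by ring
          _ = c j * y j := by rw [hw j, one_mul]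
    rw [this]; exact hc
  have hmem : c i * w i ∈ maximalIdeal S := hli _ hc' i
  have hwu : IsUnit (w i) := IsUnit.of_mul_eq_one (v i) (hw i)
  exact (Ideal.mul_unit_mem_iff_mem _ hwu).mp hmem

omit h𝔭 in
/-- Linear independence of cotangent classes DESCENDS along any local homomorphism of local rings (relations
`Σ cᵢ xᵢ ∈ 𝔪²` push forward). [OURS · bookkeeping] -/
theorem linearIndependent_toCotangent_of_map {S S' : Type*} [CommRing S] [CommRing S'] [IsLocalRing S]
    [IsLocalRing S'] (f : S →+* S') [IsLocalHom f] {ι : Type*} [Fintype ι] (x : ι → S)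
    (hx : ∀ i, x i ∈ maximalIdeal S) (hfx : ∀ i, f (x i) ∈ maximalIdeal S')
    (hli : LinearIndependent (ResidueField S') fun i => (maximalIdeal S').toCotangent ⟨f (x i), hfx i⟩) :
    LinearIndependent (ResidueField S) fun i => (maximalIdeal S).toCotangent ⟨x i, hx i⟩ := by
  rw [linearIndependent_toCotangent_iff_forall_mem] at hli ⊢
  intro c hc i
  have hc' : ∑ i, f (c i) * f (x i) ∈ maximalIdeal S' ^ 2 := by
    have : ∑ i, f (c i) * f (x i) = f (∑ i, c i * x i) := by simp [map_sum, map_mul]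
    rw [this]
    have h2 : (maximalIdeal S ^ 2).map f ≤ maximalIdeal S' ^ 2 := by
      rw [Ideal.map_pow]
      exact Ideal.pow_right_mono (IsLocalRing.map_maximalIdeal_le f) 2
    exact h2 (Ideal.mem_map_of_mem f hc)
  have := hli _ hc' i
  exact (IsLocalRing.mem_maximalIdeal _).mpr
    ((map_mem_nonunits_iff f (c i)).mp ((IsLocalRing.mem_maximalIdeal _).mp this))

/-- Linear independence of cotangent classes ASCENDS along the localised map of a smooth ring map (flat local map
with regular closed fibre; tree `linearIndependent_toCotangent_map_of_flat_of_isRegularLocalRing_fibre`).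
[OURS · bookkeeping] -/
theorem linearIndependent_toCotangent_localRingHom_of_smooth [IsNoetherianRing A] [IsNoetherianRing C]
    (hφ : φ.Smooth) {ι : Type*} [Fintype ι] (x : ι → Localization.AtPrime 𝔭)
    (hx : ∀ i, x i ∈ maximalIdeal (Localization.AtPrime 𝔭))
    (hli : LinearIndependent (ResidueField (Localization.AtPrime 𝔭))
      fun i => (maximalIdeal (Localization.AtPrime 𝔭)).toCotangent ⟨x i, hx i⟩)
    (hx' : ∀ i, Localization.localRingHom 𝔭 𝔓 φ h𝔭 (x i) ∈ maximalIdeal (Localization.AtPrime 𝔓)) :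
    LinearIndependent (ResidueField (Localization.AtPrime 𝔓))
      fun i => (maximalIdeal (Localization.AtPrime 𝔓)).toCotangent ⟨Localization.localRingHom 𝔭 𝔓 φ h𝔭 (x i), hx' i⟩ := by
  letI algSS' : Algebra (Localization.AtPrime 𝔭) (Localization.AtPrime 𝔓) :=
    (Localization.localRingHom 𝔭 𝔓 φ h𝔭).toAlgebra
  obtain ⟨h1, h2⟩ := formallySmooth_essFiniteType_localRingHom φ 𝔓 𝔭 h𝔭 hφ
  haveI := h1
  haveI := h2
  haveI : Module.Flat (Localization.AtPrime 𝔭) (Localization.AtPrime 𝔓) := flat_localRingHom φ 𝔓 𝔭 h𝔭 hφ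
  haveI : IsLocalHom (algebraMap (Localization.AtPrime 𝔭) (Localization.AtPrime 𝔓)) :=
    Localization.isLocalHom_localRingHom 𝔭 𝔓 φ h𝔭
  haveI := isRegularLocalRing_fiber (Localization.AtPrime 𝔭) (Localization.AtPrime 𝔓)
  exact linearIndependent_toCotangent_map_of_flat_of_isRegularLocalRing_fibre x hx hli

/-- (c11)≤d READ ALONG A SMOOTH RING MAP: for `A_𝔭`, `C_𝔓` regular with `dim C_𝔓 ≤ d`,
`ι(C_𝔓, φ f) = ι(A_𝔭, f)` and `J(C_𝔓, φ f)_m = J(A_𝔭, f)_m · C_𝔓`. [OURS · bookkeeping for (c11)] -/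
theorem iotaJ_localization_eq_of_smooth {d : ℕ} {ι : (R : Type) → [CommRing R] → R → Ordinal.{0}}
    {J : (R : Type) → [CommRing R] → R → ℕ → Ideal R} (hc11 : IotaJEssSmoothCompatibleLE d ι J) (hφ : φ.Smooth)
    [IsRegularLocalRing (Localization.AtPrime 𝔭)] [IsRegularLocalRing (Localization.AtPrime 𝔓)]
    (hd : ringKrullDim (Localization.AtPrime 𝔓) ≤ d) (f : A) :
    ι (Localization.AtPrime 𝔓) (algebraMap C _ (φ f)) = ι (Localization.AtPrime 𝔭) (algebraMap A _ f) ∧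
      ∀ m : ℕ, J (Localization.AtPrime 𝔓) (algebraMap C _ (φ f)) m =
        (J (Localization.AtPrime 𝔭) (algebraMap A _ f) m).map (Localization.localRingHom 𝔭 𝔓 φ h𝔭) := by
  letI algSS' : Algebra (Localization.AtPrime 𝔭) (Localization.AtPrime 𝔓) :=
    (Localization.localRingHom 𝔭 𝔓 φ h𝔭).toAlgebra
  obtain ⟨h1, h2⟩ := formallySmooth_essFiniteType_localRingHom φ 𝔓 𝔭 h𝔭 hφ
  haveI := h1
  haveI := h2
  haveI : IsLocalHom (algebraMap (Localization.AtPrime 𝔭) (Localization.AtPrime 𝔓)) :=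
    Localization.isLocalHom_localRingHom 𝔭 𝔓 φ h𝔭
  have key := hc11 (Localization.AtPrime 𝔭) (Localization.AtPrime 𝔓) (algebraMap A _ f) hd
  have hφf : algebraMap (Localization.AtPrime 𝔭) (Localization.AtPrime 𝔓) (algebraMap A _ f) =
      algebraMap C _ (φ f) := Localization.localRingHom_to_map 𝔭 𝔓 φ h𝔭 f
  rw [hφf] at key
  exact key

/-- ORDER READ ALONG A SMOOTH RING MAP: `f ∈ 𝔪_𝔭ⁿ ↔ φ f ∈ 𝔪_𝔓ⁿ` (the tree's
`mem_pow_maximalIdeal_iff_of_formallySmooth_essFiniteType`). [OURS · bookkeeping] -/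
theorem mem_pow_maximalIdeal_localization_iff_of_smooth [IsNoetherianRing A] [IsNoetherianRing C] (hφ : φ.Smooth)
    (n : ℕ) (f : A) :
    algebraMap A (Localization.AtPrime 𝔭) f ∈ maximalIdeal (Localization.AtPrime 𝔭) ^ n ↔
      algebraMap C (Localization.AtPrime 𝔓) (φ f) ∈ maximalIdeal (Localization.AtPrime 𝔓) ^ n := by
  letI algSS' : Algebra (Localization.AtPrime 𝔭) (Localization.AtPrime 𝔓) :=
    (Localization.localRingHom 𝔭 𝔓 φ h𝔭).toAlgebra
  obtain ⟨h1, h2⟩ := formallySmooth_essFiniteType_localRingHom φ 𝔓 𝔭 h𝔭 hφ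
  haveI := h1
  haveI := h2
  haveI : IsLocalHom (algebraMap (Localization.AtPrime 𝔭) (Localization.AtPrime 𝔓)) :=
    Localization.isLocalHom_localRingHom 𝔭 𝔓 φ h𝔭
  rw [mem_pow_maximalIdeal_iff_of_formallySmooth_essFiniteType (S' := Localization.AtPrime 𝔓) n
    (algebraMap A (Localization.AtPrime 𝔭) f)]
  change Localization.localRingHom 𝔭 𝔓 φ h𝔭 (algebraMap A (Localization.AtPrime 𝔭) f) ∈ _ ↔ _
  rw [Localization.localRingHom_to_map]

end LocalizedSmooth

end E2Model

end Summit.ResolutionOfSingularities.ResolutionOfSingularities.Cruxes.HypersurfaceCentreConstruction.LocalEngine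

end
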